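import Summits.AtomisticToContinuum.Crystallization.Theorems.ChessboardParticlePlanesLjPlaneChessboardYukawaSlicing
import Mathlib.MeasureTheory.Function.JacobianOneDim

/-!
# Crux `ChessboardParticlePlanes.LjPlaneChessboard` (stmt-AtomisticToContinuum-6709), line `Sketch`,
# stub `sliceSubstitution` — the substitution `λ = √(m² + q²)` in a Yukawa slice

After the Yukawa slicing `V_LJ(R) = ∫₀^∞ ω(m) e^{-mR}/R dm`, `ω(m) = m¹⁰/43545600 - m⁴/144`
(`stub_yukawaSlicing`) and the planar mode expansion, the slice at in-plane wavenumber `q ≥ 0`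
and vertical offset `z > 0` contributes `e^{-z√(m²+q²)}/√(m²+q²)`.  The change of variables
`λ = √(m² + q²)` (`m = √(λ² - q²)`, `dm/√(m²+q²) = dλ/√(λ²-q²)`) turns the `m`-integral into the
Laplace-transform form
`∫₀^∞ ω(m) e^{-z√(m²+q²)}/√(m²+q²) dm = -∫_q^∞ W(q,λ) e^{-λz} dλ`,
`W(q,λ) = (λ²-q²)^{3/2}/144 - (λ²-q²)^{9/2}/43545600` (written with `Real.sqrt`:
`(λ²-q²)^{3/2} = (λ²-q²)√(λ²-q²)`, `(λ²-q²)^{9/2} = (λ²-q²)⁴√(λ²-q²)`), together with the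
integrability of `W(q,·) e^{-·z}` on `(q, ∞)`.

Route (Mathlib only): the one-dimensional change-of-variables formula for monotone maps
`MeasureTheory.integral_image_eq_integral_deriv_smul_of_monotoneOn` with `f m = √(m²+q²)`
(monotone on `(0,∞)`, image `(q,∞)`, derivative `m/√(m²+q²)`); integrability by domination
`|W(q,λ)| ≤ λ³/144 + λ⁹/43545600` and Euler's integrals (`integrableOn_pow_mul_exp_neg_mul_Ioi`).

Main results:
* `image_sqrt_sq_add_sq_Ioi`, `hasDerivAt_sqrt_sq_add_sq`, `monotoneOn_sqrt_sq_add_sq` :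
  the substitution map;
* `abs_sliceWeight_le`, `integrableOn_sliceWeight_mul_exp` : the domination;
* `sliceSubstitution` : the registered stub.
[folklore]
-/

noncomputable section

namespace Summit.AtomisticToContinuum.Crystallization.Theorems.ChessboardParticlePlanesLjPlaneChessboard

open MeasureTheory Set

/-! ## The substitution map `m ↦ √(m² + q²)` on `(0, ∞)` -/

/-- For `q ≥ 0`, `m ↦ √(m² + q²)` maps `(0, ∞)` onto `(q, ∞)` (inverse `λ ↦ √(λ² - q²)`).
[folklore] -/
theorem image_sqrt_sq_add_sq_Ioi {q : ℝ} (hq : 0 ≤ q) :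
    (fun m : ℝ => Real.sqrt (m ^ 2 + q ^ 2)) '' Ioi 0 = Ioi q := by
  ext l
  constructor
  · rintro ⟨m, hm, rfl⟩
    rw [mem_Ioi] at hm ⊢
    calc q = Real.sqrt (q ^ 2) := (Real.sqrt_sq hq).symm
      _ < Real.sqrt (m ^ 2 + q ^ 2) := Real.sqrt_lt_sqrt (sq_nonneg q) (by nlinarith)
  · intro hl
    rw [mem_Ioi] at hl
    have hl0 : 0 ≤ l := hq.trans hl.le
    have hpos : 0 < l ^ 2 - q ^ 2 := by nlinarith
    refine ⟨Real.sqrt (l ^ 2 - q ^ 2), Real.sqrt_pos.2 hpos, ?_⟩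
    show Real.sqrt (Real.sqrt (l ^ 2 - q ^ 2) ^ 2 + q ^ 2) = l
    rw [Real.sq_sqrt hpos.le, sub_add_cancel, Real.sqrt_sq hl0]

/-- The derivative of `m ↦ √(m² + q²)` at `m > 0` is `m/√(m² + q²)`. [folklore] -/
theorem hasDerivAt_sqrt_sq_add_sq (q : ℝ) {m : ℝ} (hm : 0 < m) :
    HasDerivAt (fun m : ℝ => Real.sqrt (m ^ 2 + q ^ 2)) (m / Real.sqrt (m ^ 2 + q ^ 2)) m := by
  have h1 : HasDerivAt (fun m : ℝ => m ^ 2 + q ^ 2) (2 * m) m := by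
    simpa using (hasDerivAt_pow 2 m).add_const (q ^ 2)
  have hne : m ^ 2 + q ^ 2 ≠ 0 := by positivity
  convert h1.sqrt hne using 1
  rw [mul_div_mul_left _ _ (two_ne_zero' ℝ)]

/-- `m ↦ √(m² + q²)` is monotone on `(0, ∞)`. [folklore] -/
theorem monotoneOn_sqrt_sq_add_sq (q : ℝ) :
    MonotoneOn (fun m : ℝ => Real.sqrt (m ^ 2 + q ^ 2)) (Ioi 0) := by
  intro a ha b hb hab
  rw [mem_Ioi] at ha hb
  exact Real.sqrt_le_sqrt (by nlinarith)

/-! ## Domination of the slice weight -/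

/-- The slice weight is polynomially bounded: for `0 ≤ q ≤ λ`,
`|(λ²-q²)√(λ²-q²)/144 - (λ²-q²)⁴√(λ²-q²)/43545600| ≤ λ³/144 + λ⁹/43545600`
(as `0 ≤ √(λ²-q²) ≤ λ`). [folklore] -/
theorem abs_sliceWeight_le {q l : ℝ} (hq : 0 ≤ q) (hl : q ≤ l) :
    |(l ^ 2 - q ^ 2) * Real.sqrt (l ^ 2 - q ^ 2) / 144
        - (l ^ 2 - q ^ 2) ^ 4 * Real.sqrt (l ^ 2 - q ^ 2) / 43545600| ≤
      l ^ 3 / 144 + l ^ 9 / 43545600 := by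
  have hl0 : 0 ≤ l := hq.trans hl
  have ht0 : 0 ≤ l ^ 2 - q ^ 2 := by nlinarith
  have hsl : Real.sqrt (l ^ 2 - q ^ 2) ≤ l :=
    (Real.sqrt_le_left hl0).2 (by nlinarith [sq_nonneg q])
  have hs0 : 0 ≤ Real.sqrt (l ^ 2 - q ^ 2) := Real.sqrt_nonneg _
  have hts : l ^ 2 - q ^ 2 = Real.sqrt (l ^ 2 - q ^ 2) ^ 2 := (Real.sq_sqrt ht0).symm
  set s := Real.sqrt (l ^ 2 - q ^ 2)
  rw [hts]
  have h3 : s ^ 3 ≤ l ^ 3 := pow_le_pow_left₀ hs0 hsl 3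
  have h9 : s ^ 9 ≤ l ^ 9 := pow_le_pow_left₀ hs0 hsl 9
  have h3' : 0 ≤ s ^ 3 := pow_nonneg hs0 3
  have h9' : 0 ≤ s ^ 9 := pow_nonneg hs0 9
  rw [show s ^ 2 * s / 144 - (s ^ 2) ^ 4 * s / 43545600 = s ^ 3 / 144 - s ^ 9 / 43545600 by ring,
    abs_le]
  constructor <;> linarith

/-- The Laplace-side slice integrand `W(q,λ) e^{-λz}` is integrable on `(q, ∞)` for `q ≥ 0`,
`z > 0`: it is continuous and dominated by `(λ³/144 + λ⁹/43545600) e^{-λz}`, integrable on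
`(0, ∞) ⊇ (q, ∞)` by Euler's integral. [folklore] -/
theorem integrableOn_sliceWeight_mul_exp {q z : ℝ} (hq : 0 ≤ q) (hz : 0 < z) :
    IntegrableOn (fun l : ℝ =>
        ((l ^ 2 - q ^ 2) * Real.sqrt (l ^ 2 - q ^ 2) / 144
          - (l ^ 2 - q ^ 2) ^ 4 * Real.sqrt (l ^ 2 - q ^ 2) / 43545600) * Real.exp (-(l * z)))
      (Ioi q) := by
  have hdom : IntegrableOn (fun l : ℝ => (l ^ 3 / 144 + l ^ 9 / 43545600) * Real.exp (-(l * z)))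
      (Ioi q) := by
    have hsum : IntegrableOn (fun l : ℝ => 1 / 144 * (l ^ 3 * Real.exp (-(l * z)))
        + 1 / 43545600 * (l ^ 9 * Real.exp (-(l * z)))) (Ioi 0) :=
      ((integrableOn_pow_mul_exp_neg_mul_Ioi 3 hz).const_mul (1 / 144)).add
        ((integrableOn_pow_mul_exp_neg_mul_Ioi 9 hz).const_mul (1 / 43545600))
    refine (hsum.mono_set (Ioi_subset_Ioi hq)).congr_fun (fun l _ => ?_) measurableSet_Ioi
    ring
  refine hdom.mono' ?_ ?_
  · have hcont : Continuous (fun l : ℝ =>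
        ((l ^ 2 - q ^ 2) * Real.sqrt (l ^ 2 - q ^ 2) / 144
          - (l ^ 2 - q ^ 2) ^ 4 * Real.sqrt (l ^ 2 - q ^ 2) / 43545600) * Real.exp (-(l * z))) := by
      fun_prop
    exact hcont.aestronglyMeasurable
  · filter_upwards [ae_restrict_mem measurableSet_Ioi] with l hl
    rw [mem_Ioi] at hl
    rw [Real.norm_eq_abs, abs_mul, Real.abs_exp]
    exact mul_le_mul_of_nonneg_right (abs_sliceWeight_le hq hl.le) (Real.exp_pos _).le

/-! ## The registered stub -/

/-- **Stub `sliceSubstitution` — the substitution `λ = √(m² + q²)` in a Yukawa slice.**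
For `q ≥ 0` and `z > 0`, the Laplace-side slice integrand
`W(q,λ) e^{-λz}`, `W(q,λ) = (λ²-q²)√(λ²-q²)/144 - (λ²-q²)⁴√(λ²-q²)/43545600`, is integrable on
`(q, ∞)`, and
`∫₀^∞ (m¹⁰/43545600 - m⁴/144) e^{-z√(m²+q²)}/√(m²+q²) dm = -∫_q^∞ W(q,λ) e^{-λz} dλ`
(change of variables `λ = √(m²+q²)`: `λ² - q² = m²`, `dm/√(m²+q²) = dλ/m`, and
`ω(m)/m = m⁹/43545600 - m³/144 = -W(q,λ)`). [folklore] -/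
theorem sliceSubstitution :
    ∀ (q z : ℝ), 0 ≤ q → 0 < z →
      MeasureTheory.IntegrableOn (fun l : ℝ =>
          ((l ^ 2 - q ^ 2) * Real.sqrt (l ^ 2 - q ^ 2) / 144
            - (l ^ 2 - q ^ 2) ^ 4 * Real.sqrt (l ^ 2 - q ^ 2) / 43545600) * Real.exp (-(l * z)))
        (Set.Ioi q) ∧
      ∫ m in Set.Ioi (0 : ℝ), (m ^ 10 / 43545600 - m ^ 4 / 144) *
          (Real.exp (-(z * Real.sqrt (m ^ 2 + q ^ 2))) / Real.sqrt (m ^ 2 + q ^ 2)) =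
        -∫ l in Set.Ioi q, ((l ^ 2 - q ^ 2) * Real.sqrt (l ^ 2 - q ^ 2) / 144
            - (l ^ 2 - q ^ 2) ^ 4 * Real.sqrt (l ^ 2 - q ^ 2) / 43545600) * Real.exp (-(l * z)) := by
  intro q z hq hz
  refine ⟨integrableOn_sliceWeight_mul_exp hq hz, ?_⟩
  have key := integral_image_eq_integral_deriv_smul_of_monotoneOn measurableSet_Ioi
    (fun m (hm : m ∈ Ioi (0 : ℝ)) => (hasDerivAt_sqrt_sq_add_sq q (mem_Ioi.1 hm)).hasDerivWithinAt)
    (monotoneOn_sqrt_sq_add_sq q)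
    (fun l : ℝ => ((l ^ 2 - q ^ 2) * Real.sqrt (l ^ 2 - q ^ 2) / 144
      - (l ^ 2 - q ^ 2) ^ 4 * Real.sqrt (l ^ 2 - q ^ 2) / 43545600) * Real.exp (-(l * z)))
  rw [image_sqrt_sq_add_sq_Ioi hq] at key
  rw [key, ← integral_neg]
  refine setIntegral_congr_fun measurableSet_Ioi (fun m hm => ?_)
  rw [mem_Ioi] at hm
  have hmq : 0 ≤ m ^ 2 + q ^ 2 := by positivity
  simp only [smul_eq_mul]
  rw [Real.sq_sqrt hmq, add_sub_cancel_right, Real.sqrt_sq hm.le,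
    mul_comm (Real.sqrt (m ^ 2 + q ^ 2)) z]
  ring

end Summit.AtomisticToContinuum.Crystallization.Theorems.ChessboardParticlePlanesLjPlaneChessboard

end
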